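import Literature.Geometry.Riemannian.BoundaryNormalCoordinates
import Literature.Geometry.Riemannian.GeneralizedCylinderScalarCurvature
import Literature.Geometry.Lorentzian.HypersurfaceNaturality
import Literature.Geometry.Lorentzian.HypersurfaceRestriction
import Literature.Geometry.Manifold.OpenSubmanifoldTangent
import HarnessLib

/-!
# The boundary cylinder at `t = 0`: first fundamental form and mean curvature
# (Bär–Hanke 2023, §3, (7)–(8) and the sign conventions of `BaerHankePscGluing`)

Topic `Literature/Geometry/Riemannian`. A brick of the proof programme of
`Literature.Geometry.Riemannian.BaerHankePscGluing`: it connects the hypotheses of that fact —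
the boundary metric `incl^* g_M` and the mean curvature `H_{g_M}(incl, ν_M)` of `∂M` w.r.t. the
OUTWARD unit normal `ν_M` — with the data of the generalized cylinder `G` on `∂M × ℝ` built from
boundary normal coordinates (`BoundaryCylinderMetric.lean`: `G = E^*ĝ` near `t = 0`, where
`E(z, t) = exp^{ĝ}(t · d(jM)(-ν_M z))` and `ĝ` extends `g_M` along `jM : M ↪ P`):

* `metric_ext'`, `meanCurvature_congr_metric'`, `meanCurvature_congr_fun`,
  `meanCurvature_neg_normal` —
  bookkeeping: equal metrics / pointwise equal immersions and normals give equal mean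
  curvatures; `H_{-ν} = -H_{ν}`;
* `boundaryCylinder_sliceZero_val` — **`g_0 = incl^* g_M`**:
  `G_{(z,0)}((v,0),(w,0)) = g_M(d incl v, d incl w)`;
* `boundaryCylinder_sliceZero_meanCurvature` — **`H^G_0 = -H_{g_M}(incl, ν_M)`**: the mean
  curvature of the slice `t = 0` of the cylinder w.r.t. `∂_t` (which points INTO `M`) is minus
  the mean curvature of `∂M ⊂ (M, g_M)` w.r.t. the outward normal (naturality of `H` under the
  local isometries `E` and `jM`, `meanCurvature_comap`, localized to the open slab via
  `TopologicalSpace.Opens`, and `H_{-ν} = -H_ν`). Consequently Bär–Hanke's hypothesis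
  `H_{g_M} + H_{g_N} ≥ 0` (their `H` w.r.t. the interior normals, tree's `H_tree = -(n+1) H_BH`
  bookkeeping in `BaerHankeGluing.lean`) reads `H^{G_M}_0 + H^{G_N}_0 ≤ 0` on the two cylinders.

No definitions, no named facts (D-0026).

## References

* C. Bär, B. Hanke, *Boundary conditions for scalar curvature*, arXiv:2012.09127, §3, (7)–(8).
  [BarHanke2023]
* B. O'Neill, *Semi-Riemannian geometry* (1983), Ch. 3, Prop. 3.59; Ch. 4, Lemma 4.4 ff.
  [ONeill1983]
-/

noncomputable section

open Bundle Set Function Filter Metric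
open scoped Manifold ContDiff Topology

attribute [-instance] SimplexCategory.instFintypeToTypeOrderHomFinHAddNatLenOfNat

namespace Literature.Geometry.Riemannian

open Literature.Geometry.Lorentzian Literature.Geometry.Lorentzian.PseudoRiemannianMetric

/-! ### Bookkeeping lemmas for the mean curvature -/

section Bookkeeping

variable {E : Type*} [NormedAddCommGroup E] [NormedSpace ℝ E] {H : Type*} [TopologicalSpace H]
  {I : ModelWithCorners ℝ E H} {M : Type*} [TopologicalSpace M] [ChartedSpace H M]
  [IsManifold I ∞ M] [FiniteDimensional ℝ E] [CompleteSpace E] {n : ℕ∞ω} [Fact (1 ≤ n)]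
  {E' : Type*} [NormedAddCommGroup E'] [NormedSpace ℝ E'] {H' : Type*} [TopologicalSpace H']
  {I' : ModelWithCorners ℝ E' H'} {N : Type*} [TopologicalSpace N] [ChartedSpace H' N]
  [FiniteDimensional ℝ E'] [IsManifold I' ∞ N]

omit [CompleteSpace E] [Fact (1 ≤ n)] in
/-- Equal metrics have equal mean curvatures (whatever the proofs of the standing hypotheses).
[folklore] -/
theorem meanCurvature_congr_metric'
    {g₁ g₂ : PseudoRiemannianMetric I n E (TangentSpace I : M → Type _)} (h : g₁ = g₂)
    [i₁ : g₁.HasLeviCivita] [i₂ : g₂.HasLeviCivita] (f : N → M)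
    (hpb : contMDiff_pullbackBilin I M I' N n)
    (hf₁ : g₁.IsSpacelikeImmersion I' f) (hf₂ : g₂.IsSpacelikeImmersion I' f)
    (ν : NormalField I f) (y : N) :
    g₁.meanCurvature f hpb hf₁ ν y = g₂.meanCurvature f hpb hf₂ ν y := by
  subst h; rfl

omit [FiniteDimensional ℝ E] [CompleteSpace E] [Fact (1 ≤ n)] in
/-- Two metrics with the same values are equal (the remaining fields are propositions).
[folklore] -/
theorem metric_ext' {g₁ g₂ : PseudoRiemannianMetric I n E (TangentSpace I : M → Type _)}
    (h : ∀ b, g₁.val b = g₂.val b) : g₁ = g₂ := by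
  obtain ⟨v₁, s₁, n₁, c₁⟩ := g₁
  obtain ⟨v₂, s₂, n₂, c₂⟩ := g₂
  obtain rfl : v₁ = v₂ := funext h
  rfl

omit [CompleteSpace E] [Fact (1 ≤ n)] in
/-- Pointwise equal immersions with pointwise equal normal fields (read in the model space) have
equal mean curvatures. [folklore] -/
theorem meanCurvature_congr_fun
    (g : PseudoRiemannianMetric I n E (TangentSpace I : M → Type _)) [g.HasLeviCivita]
    {f₁ f₂ : N → M} (h : f₁ = f₂) {ν₁ : NormalField I f₁} {ν₂ : NormalField I f₂}
    (hν : ∀ y, (ν₁ y : E) = (ν₂ y : E)) (hpb : contMDiff_pullbackBilin I M I' N n)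
    (hf₁ : g.IsSpacelikeImmersion I' f₁) (hf₂ : g.IsSpacelikeImmersion I' f₂) (y : N) :
    g.meanCurvature f₁ hpb hf₁ ν₁ y = g.meanCurvature f₂ hpb hf₂ ν₂ y := by
  subst h
  obtain rfl : ν₁ = ν₂ := funext hν
  rfl

omit [CompleteSpace E] [Fact (1 ≤ n)] [FiniteDimensional ℝ E'] [IsManifold I' ∞ N] in
/-- `D(a W)/dt = a DW/dt` in the canonical frame, unconditionally (copy of
`covariantDerivAlong_const_smul` of `NullInwardPencil.lean`, to keep trapped-surface theory out
of the import closure). [folklore] -/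
private theorem covariantDerivAlong_const_smul_aux
    (cov : CovariantDerivative I E (TangentSpace I : M → Type _)) (γ : ℝ → M)
    (W : Π t : ℝ, TangentSpace I (γ t)) (t₀ a : ℝ) :
    covariantDerivAlong cov γ (fun t ↦ a • W t) t₀ = a • covariantDerivAlong cov γ W t₀ := by
  show covariantDerivAlongFrame cov _ _ γ (fun t ↦ a • W t) t₀ =
    a • covariantDerivAlongFrame cov _ _ γ W t₀
  simp only [covariantDerivAlongFrame, map_smul, smul_eq_mul, deriv_const_mul_field, mul_smul,
    smul_add, Finset.smul_sum]

variable (g : PseudoRiemannianMetric I n E (TangentSpace I : M → Type _)) [g.HasLeviCivita]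

omit [CompleteSpace E] [Fact (1 ≤ n)] [FiniteDimensional ℝ E'] [IsManifold I' ∞ N] in
/-- `D_v(-ν) = -D_v ν`. [folklore] -/
theorem normalDerivAlong_neg (f : N → M) (ν : NormalField I f) (y : N) (v : TangentSpace I' y) :
    (g.normalDerivAlong f (fun y ↦ -ν y) y v : E) = -(g.normalDerivAlong f ν y v : E) := by
  show (covariantDerivAlong g.leviCivita (f ∘ curveThrough I' y v)
      (fun t ↦ -ν (curveThrough I' y v t)) 0 : E) =
    -(covariantDerivAlong g.leviCivita (f ∘ curveThrough I' y v)
      (fun t ↦ ν (curveThrough I' y v t)) 0 : E)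
  have h1 : covariantDerivAlong g.leviCivita (f ∘ curveThrough I' y v)
      (fun t ↦ -ν (curveThrough I' y v t)) 0 =
      covariantDerivAlong g.leviCivita (f ∘ curveThrough I' y v)
        (fun t ↦ (-1 : ℝ) • ν (curveThrough I' y v t)) 0 := by
    congr 1
    funext t
    exact (neg_one_smul ℝ _).symm
  have h2 := covariantDerivAlong_const_smul_aux g.leviCivita (f ∘ curveThrough I' y v)
    (fun t ↦ ν (curveThrough I' y v t)) 0 (-1)
  exact (h1.trans h2).trans (neg_one_smul ℝ _)

omit [CompleteSpace E] [Fact (1 ≤ n)] in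
/-- **`K_{-ν} = -K_ν`**: the second fundamental form is linear in the normal field (at an
interior point where the lifts of `ν` and `-ν` are differentiable). O'Neill 1983, Ch. 4,
Lemma 4.4 ff. [cite: ONeill1983, Ch. 4, Lemma 4.4] -/
theorem secondFundamentalForm_neg_normal {f : N → M} {ν : NormalField I f} {y : N}
    (hy : I'.IsInteriorPoint y)
    (hν : MDifferentiableAt I' I.tangent
      (fun y ↦ (TotalSpace.mk' E (f y) (ν y) : TangentBundle I M)) y)
    (hν' : MDifferentiableAt I' I.tangent
      (fun y ↦ (TotalSpace.mk' E (f y) (-ν y) : TangentBundle I M)) y) :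
    g.secondFundamentalForm I' f (fun y ↦ -ν y) y = -g.secondFundamentalForm I' f ν y := by
  refine LinearMap.ext fun v ↦ LinearMap.ext fun w ↦ ?_
  rw [LinearMap.neg_apply, LinearMap.neg_apply,
    g.secondFundamentalForm_apply_holds (I' := I') hy hν' v w,
    g.secondFundamentalForm_apply_holds (I' := I') hy hν v w]
  have h := normalDerivAlong_neg g f ν y v
  show g.val (f y) (g.normalDerivAlong f (fun y ↦ -ν y) y v : E) (mfderiv I' I f y w) =
    -g.val (f y) (g.normalDerivAlong f ν y v : E) (mfderiv I' I f y w)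
  rw [h, map_neg, _root_.neg_apply]

omit [CompleteSpace E] [Fact (1 ≤ n)] in
/-- **`H_{-ν} = -H_ν`** (the metric trace is linear). [cite: ONeill1983, Ch. 4, Lemma 4.4] -/
theorem meanCurvature_neg_normal {f : N → M} (hpb : contMDiff_pullbackBilin I M I' N n)
    (hf : g.IsSpacelikeImmersion I' f) {ν : NormalField I f} {y : N}
    (hy : I'.IsInteriorPoint y)
    (hν : MDifferentiableAt I' I.tangent
      (fun y ↦ (TotalSpace.mk' E (f y) (ν y) : TangentBundle I M)) y)
    (hν' : MDifferentiableAt I' I.tangent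
      (fun y ↦ (TotalSpace.mk' E (f y) (-ν y) : TangentBundle I M)) y) :
    g.meanCurvature f hpb hf (fun y ↦ -ν y) y = -g.meanCurvature f hpb hf ν y := by
  unfold meanCurvature
  rw [secondFundamentalForm_neg_normal g hy hν hν']
  simp only [PseudoRiemannianMetric.trace, LinearMap.comp_neg, map_neg]

end Bookkeeping

/-! ### Fields along maps into open submanifolds -/

section OpensTangent

variable {E : Type*} [NormedAddCommGroup E] [NormedSpace ℝ E] {H : Type*} [TopologicalSpace H]
  {I : ModelWithCorners ℝ E H} {M : Type*} [TopologicalSpace M] [ChartedSpace H M]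
  [IsManifold I ∞ M]
  {EX : Type*} [NormedAddCommGroup EX] [NormedSpace ℝ EX] {HX : Type*} [TopologicalSpace HX]
  {IX : ModelWithCorners ℝ EX HX} {X : Type*} [TopologicalSpace X] [ChartedSpace HX X]

/-- The preferred trivializations of `TU` and `TM` have the same fibre coordinates (copy of
`trivializationAt_tangentSpace_opens_snd` of `LorentzianMetricProofs.lean`, kept out of the import
closure). [folklore] -/
private theorem trivializationAt_tangentSpace_opens_snd_aux (U : TopologicalSpace.Opens M)
    (x₀ x : U) (v : E) :
    ((trivializationAt E (TangentSpace I) x₀) (TotalSpace.mk' E x v : TangentBundle I U)).2 =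
      ((trivializationAt E (TangentSpace I) (x₀ : M))
        (TotalSpace.mk' E (x : M) v : TangentBundle I M)).2 := by
  change tangentCoordChange I x x₀ x v = tangentCoordChange I (x : M) (x₀ : M) (x : M) v
  rw [Manifold.OpenSubmanifold.tangentCoordChange_eq x x₀ x (mem_chart_source H (x : M))]

omit [IsManifold I ∞ M] in
/-- A map into an open submanifold is differentiable iff its composite with the inclusion is.
[folklore] -/
private theorem mdifferentiableAt_subtypeVal_comp_iff_aux (U : TopologicalSpace.Opens M)
    {b : X → U} {x₀ : X} :
    MDifferentiableAt IX I (Subtype.val ∘ b) x₀ ↔ MDifferentiableAt IX I b x₀ :=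
  ChartedSpace.liftPropWithinAt_subtypeVal_comp_iff (P := DifferentiableWithinAtProp IX I) b univ
    x₀

/-- **A field along a map into an open submanifold is differentiable as a map into `TU` iff it is
as a map into `TM`** (copy of `mdifferentiableAt_totalSpace_opens_iff` of
`CauchyDevelopmentRestrict.lean`, kept out of the import closure). [folklore] -/
theorem mdifferentiableAt_totalSpace_opens_iff' (U : TopologicalSpace.Opens M) {b : X → U}
    {s : Π x : X, TangentSpace I (b x)} {x₀ : X} :
    MDifferentiableAt IX I.tangent
        (fun x ↦ (TotalSpace.mk' E (b x) (s x) : TangentBundle I U)) x₀ ↔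
      MDifferentiableAt IX I.tangent
        (fun x ↦ (TotalSpace.mk' E (b x : M) (s x) : TangentBundle I M)) x₀ := by
  rw [mdifferentiableAt_totalSpace, mdifferentiableAt_totalSpace,
    ← mdifferentiableAt_subtypeVal_comp_iff_aux U (b := b)]
  refine and_congr_right fun _ ↦ ?_
  have h : (fun x ↦ ((trivializationAt E (TangentSpace I) (b x₀))
      (TotalSpace.mk' E (b x) (s x) : TangentBundle I U)).2) =
      fun x ↦ ((trivializationAt E (TangentSpace I) (b x₀ : M))
        (TotalSpace.mk' E (b x : M) (s x) : TangentBundle I M)).2 :=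
    funext fun x ↦ trivializationAt_tangentSpace_opens_snd_aux (I := I) U (b x₀) (b x) (s x)
  rw [h]

end OpensTangent

/-! ### The slice `t = 0` of the boundary cylinder -/

section SliceZero

open Literature.Topology.FourManifolds

universe u

variable {n : ℕ} {M : Type u} [TopologicalSpace M] [ChartedSpace (EuclideanHalfSpace (n + 2)) M]
  [IsManifold (𝓡∂ (n + 2)) ∞ M]
  {P : Type u} [TopologicalSpace P] [ChartedSpace (EuclideanSpace ℝ (Fin (n + 2))) P]
  [IsManifold (𝓡 (n + 2)) ∞ P] [T2Space P]
  (bM : BoundaryData (𝓡∂ (n + 2)) M (𝓡 (n + 1)))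

set_option synthInstance.maxHeartbeats 400000 in
set_option maxHeartbeats 1600000 in
/-- **The first fundamental form of the slice `t = 0` of the boundary cylinder is `incl^* g_M`**:
with `E(z, t) = exp^{ĝ}_{jM(incl z)}(t · d(jM)(-ν_M z))` and `G = E^*ĝ` near `t = 0`,
`G_{(z,0)}((v,0),(w,0)) = g_M(d incl v, d incl w)` (`dE_{(z,0)}(v, 0) = d(jM ∘ incl) v`,
`mfderiv_normalExp_zero_apply'`, and `ĝ(djM ·, djM ·) = g_M`). [cite: BarHanke2023, §3, (7)] -/
theorem boundaryCylinder_sliceZero_val {jM : M → P}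
    (hjM : Manifold.IsSmoothEmbedding (𝓡∂ (n + 2)) (𝓡 (n + 2)) ∞ jM)
    (gM : PseudoRiemannianMetric (𝓡∂ (n + 2)) ∞ (EuclideanSpace ℝ (Fin (n + 2)))
      (TangentSpace (𝓡∂ (n + 2)) : M → Type _))
    (νM : NormalField (𝓡∂ (n + 2)) bM.incl)
    (hνs : ContMDiff (𝓡 (n + 1)) (𝓡∂ (n + 2)).tangent ∞ (fun z ↦
      (TotalSpace.mk' (EuclideanSpace ℝ (Fin (n + 2))) (bM.incl z) (νM z) :
        TangentBundle (𝓡∂ (n + 2)) M)))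
    (g : PseudoRiemannianMetric (𝓡 (n + 2)) ∞ (EuclideanSpace ℝ (Fin (n + 2)))
      (TangentSpace (𝓡 (n + 2)) : P → Type _)) [g.HasLeviCivita]
    (hpull : ∀ (a : M) (v w : TangentSpace (𝓡∂ (n + 2)) a),
      g.val (jM a) (mfderiv (𝓡∂ (n + 2)) (𝓡 (n + 2)) jM a v)
        (mfderiv (𝓡∂ (n + 2)) (𝓡 (n + 2)) jM a w) = gM.val a v w)
    (G : PseudoRiemannianMetric ((𝓡 (n + 1)).prod 𝓘(ℝ, ℝ)) ∞
      (EuclideanSpace ℝ (Fin (n + 1)) × ℝ)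
      (TangentSpace ((𝓡 (n + 1)).prod 𝓘(ℝ, ℝ)) : bM.carrier × ℝ → Type _))
    {ε : ℝ} (hε : 0 < ε)
    (hGval : ∀ (z : bM.carrier), ∀ t ∈ Ioo (-ε) ε,
      G.val (z, t) = pullbackBilin (I := 𝓡 (n + 2)) (I' := (𝓡 (n + 1)).prod 𝓘(ℝ, ℝ))
        (fun q : bM.carrier × ℝ ↦ expMap g.leviCivita (jM (bM.incl q.1))
          (q.2 • mfderiv (𝓡∂ (n + 2)) (𝓡 (n + 2)) jM (bM.incl q.1) (-νM q.1))) g.val (z, t))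
    (z : bM.carrier) (v w : EuclideanSpace ℝ (Fin (n + 1))) :
    G.val (z, (0 : ℝ)) ((v, 0) : TangentSpace ((𝓡 (n + 1)).prod 𝓘(ℝ, ℝ)) (z, (0 : ℝ)))
        ((w, 0) : TangentSpace ((𝓡 (n + 1)).prod 𝓘(ℝ, ℝ)) (z, (0 : ℝ))) =
      gM.val (bM.incl z) (mfderiv (𝓡 (n + 1)) (𝓡∂ (n + 2)) bM.incl z v)
        (mfderiv (𝓡 (n + 1)) (𝓡∂ (n + 2)) bM.incl z w) := by
  haveI : Fact (1 ≤ (∞ : ℕ∞ω)) := ⟨by exact_mod_cast le_top⟩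
  haveI h1 : CovariantDerivative.ContMDiffCovariantDerivative g.leviCivita 1 :=
    contMDiffCovariantDerivative_leviCivita_of_two_le g (WithTop.coe_le_coe.2 le_top)
  set ι : bM.carrier → P := fun y ↦ jM (bM.incl y) with hι
  set ν : Π y : bM.carrier, TangentSpace (𝓡 (n + 2)) (ι y) :=
    fun y ↦ mfderiv (𝓡∂ (n + 2)) (𝓡 (n + 2)) jM (bM.incl y) (-νM y) with hν
  have hjMs : ContMDiff (𝓡∂ (n + 2)) (𝓡 (n + 2)) ∞ jM := hjM.contMDiff
  have hincl : ContMDiff (𝓡 (n + 1)) (𝓡∂ (n + 2)) ∞ bM.incl := bM.isSmoothEmbedding.contMDiff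
  have htan : ContMDiff (𝓡∂ (n + 2)).tangent (𝓡 (n + 2)).tangent 1
      (tangentMap (𝓡∂ (n + 2)) (𝓡 (n + 2)) jM) :=
    hjMs.contMDiff_tangentMap (by exact WithTop.coe_le_coe.2 le_top)
  have hνlift : ContMDiff (𝓡 (n + 1)) (𝓡 (n + 2)).tangent 1
      (fun y ↦ (TotalSpace.mk' (EuclideanSpace ℝ (Fin (n + 2))) (ι y) (ν y) :
        TangentBundle (𝓡 (n + 2)) P)) :=
    htan.comp ((contMDiff_totalSpaceMk_neg hνs).of_le (by exact_mod_cast le_top))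
  -- the differential of `E` at `(z, 0)` on horizontal vectors
  have hdT : ∀ u : EuclideanSpace ℝ (Fin (n + 1)),
      mfderiv ((𝓡 (n + 1)).prod 𝓘(ℝ, ℝ)) (𝓡 (n + 2))
        (fun q : bM.carrier × ℝ ↦ expMap g.leviCivita (ι q.1) (q.2 • ν q.1)) (z, 0)
        ((u, 0) : TangentSpace ((𝓡 (n + 1)).prod 𝓘(ℝ, ℝ)) (z, (0 : ℝ))) =
      mfderiv (𝓡 (n + 1)) (𝓡 (n + 2)) ι z u := by
    intro u
    rw [mfderiv_normalExp_zero_apply' (cov := g.leviCivita) (k := 1) le_rfl hνlift z u 0,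
      zero_smul, add_zero]
  have hdι : ∀ u : EuclideanSpace ℝ (Fin (n + 1)),
      (mfderiv (𝓡 (n + 1)) (𝓡 (n + 2)) ι z u : EuclideanSpace ℝ (Fin (n + 2))) =
        mfderiv (𝓡∂ (n + 2)) (𝓡 (n + 2)) jM (bM.incl z)
          (mfderiv (𝓡 (n + 1)) (𝓡∂ (n + 2)) bM.incl z u) := by
    intro u
    have h := mfderiv_comp z ((hjMs _).mdifferentiableAt (by simp))
      ((hincl z).mdifferentiableAt (by simp))
    exact DFunLike.congr_fun h u
  have h0 : (0 : ℝ) ∈ Ioo (-ε) ε := ⟨by linarith, hε⟩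
  have hT0 : expMap g.leviCivita (ι z) ((0 : ℝ) • ν z) = ι z := normalExp_zero (cov := g.leviCivita) z
  rw [hGval z 0 h0, pullbackBilin_apply]
  show g.val (expMap g.leviCivita (ι z) ((0 : ℝ) • ν z)) _ _ = _
  rw [congrArg₂ (fun a b ↦ g.val (expMap g.leviCivita (ι z) ((0 : ℝ) • ν z)) a b) (hdT v)
    (hdT w), val_congr_point (g := g) hT0]
  show g.val (jM (bM.incl z)) (mfderiv (𝓡 (n + 1)) (𝓡 (n + 2)) ι z v : EuclideanSpace ℝ
    (Fin (n + 2))) (mfderiv (𝓡 (n + 1)) (𝓡 (n + 2)) ι z w : EuclideanSpace ℝ (Fin (n + 2))) = _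
  rw [hdι v, hdι w, hpull]

set_option synthInstance.maxHeartbeats 400000 in
set_option maxHeartbeats 3200000 in
/-- **The mean curvature of the slice `t = 0` of the boundary cylinder is minus the outward mean
curvature of `∂M`**: with `E(z, t) = exp^{ĝ}_{jM(incl z)}(t · d(jM)(-ν_M z))` (`C^∞` with
injective differential for `|t| < ε`), `ĝ` an extension of `g_M` along `jM` and `G = E^*ĝ` on
`∂M × (-ε, ε)`, the mean curvature of `y ↦ (y, 0)` in `(∂M × ℝ, G)` w.r.t. `∂_t` is
`-H_{g_M}(incl, ν_M)`. Proof: restrict `G` to the open slab, where it is the honest pullback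
`(E|)^*ĝ` (O'Neill 1983, Ch. 3, Prop. 3.59: `meanCurvature_comap` along the inclusion of the slab
and along `E|`); `E(·, 0) = jM ∘ incl` with `dE(∂_t) = d(jM)(-ν_M)`; `H_{-ν} = -H_ν`; and
`meanCurvature_comap` along the equidimensional embedding `jM : (M, g_M) → (P, ĝ)`.
[cite: BarHanke2023, §3, (7)–(8)] [cite: ONeill1983, Ch. 3, Prop. 3.59 and Ch. 4, Lemma 4.4] -/
theorem boundaryCylinder_sliceZero_meanCurvature {jM : M → P}
    (hjM : Manifold.IsSmoothEmbedding (𝓡∂ (n + 2)) (𝓡 (n + 2)) ∞ jM)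
    (gM : PseudoRiemannianMetric (𝓡∂ (n + 2)) ∞ (EuclideanSpace ℝ (Fin (n + 2)))
      (TangentSpace (𝓡∂ (n + 2)) : M → Type _)) [gM.HasLeviCivita]
    (hfM : gM.IsSpacelikeImmersion (𝓡 (n + 1)) bM.incl)
    (νM : NormalField (𝓡∂ (n + 2)) bM.incl)
    (hνs : ContMDiff (𝓡 (n + 1)) (𝓡∂ (n + 2)).tangent ∞ (fun z ↦
      (TotalSpace.mk' (EuclideanSpace ℝ (Fin (n + 2))) (bM.incl z) (νM z) :
        TangentBundle (𝓡∂ (n + 2)) M)))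
    (g : PseudoRiemannianMetric (𝓡 (n + 2)) ∞ (EuclideanSpace ℝ (Fin (n + 2)))
      (TangentSpace (𝓡 (n + 2)) : P → Type _)) [g.HasLeviCivita]
    (hpull : ∀ (a : M) (v w : TangentSpace (𝓡∂ (n + 2)) a),
      g.val (jM a) (mfderiv (𝓡∂ (n + 2)) (𝓡 (n + 2)) jM a v)
        (mfderiv (𝓡∂ (n + 2)) (𝓡 (n + 2)) jM a w) = gM.val a v w)
    (G : PseudoRiemannianMetric ((𝓡 (n + 1)).prod 𝓘(ℝ, ℝ)) ∞
      (EuclideanSpace ℝ (Fin (n + 1)) × ℝ)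
      (TangentSpace ((𝓡 (n + 1)).prod 𝓘(ℝ, ℝ)) : bM.carrier × ℝ → Type _)) [G.HasLeviCivita]
    (hG : G.IsRiemannian) {ε : ℝ} (hε : 0 < ε)
    (hEs : ∀ q : bM.carrier × ℝ, q.2 ∈ Ioo (-ε) ε →
      ContMDiffAt ((𝓡 (n + 1)).prod 𝓘(ℝ, ℝ)) (𝓡 (n + 2)) ∞
        (fun q : bM.carrier × ℝ ↦ expMap g.leviCivita (jM (bM.incl q.1))
          (q.2 • mfderiv (𝓡∂ (n + 2)) (𝓡 (n + 2)) jM (bM.incl q.1) (-νM q.1))) q)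
    (hEinj : ∀ q : bM.carrier × ℝ, q.2 ∈ Ioo (-ε) ε →
      Injective (mfderiv ((𝓡 (n + 1)).prod 𝓘(ℝ, ℝ)) (𝓡 (n + 2))
        (fun q : bM.carrier × ℝ ↦ expMap g.leviCivita (jM (bM.incl q.1))
          (q.2 • mfderiv (𝓡∂ (n + 2)) (𝓡 (n + 2)) jM (bM.incl q.1) (-νM q.1))) q))
    (hGval : ∀ (z : bM.carrier), ∀ t ∈ Ioo (-ε) ε,
      G.val (z, t) = pullbackBilin (I := 𝓡 (n + 2)) (I' := (𝓡 (n + 1)).prod 𝓘(ℝ, ℝ))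
        (fun q : bM.carrier × ℝ ↦ expMap g.leviCivita (jM (bM.incl q.1))
          (q.2 • mfderiv (𝓡∂ (n + 2)) (𝓡 (n + 2)) jM (bM.incl q.1) (-νM q.1))) g.val (z, t))
    (z : bM.carrier) :
    G.meanCurvature (fun y : bM.carrier ↦ ((y, (0 : ℝ)) : bM.carrier × ℝ))
        (contMDiff_pullbackBilin_holds (I := (𝓡 (n + 1)).prod 𝓘(ℝ, ℝ))
          (M := bM.carrier × ℝ) (I' := 𝓡 (n + 1)) (N := bM.carrier))
        (isSpacelikeImmersion_cylSlice G hG 0)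
        (fun y ↦ velocity ((𝓡 (n + 1)).prod 𝓘(ℝ, ℝ))
          (fun s : ℝ ↦ ((y, s) : bM.carrier × ℝ)) 0) z =
      -gM.meanCurvature bM.incl
        (contMDiff_pullbackBilin_holds (I := 𝓡∂ (n + 2)) (M := M) (I' := 𝓡 (n + 1))
          (N := bM.carrier)) hfM νM z := by
  haveI : Fact (1 ≤ (∞ : ℕ∞ω)) := ⟨by exact_mod_cast le_top⟩
  haveI h1 : CovariantDerivative.ContMDiffCovariantDerivative g.leviCivita 1 :=
    contMDiffCovariantDerivative_leviCivita_of_two_le g (WithTop.coe_le_coe.2 le_top)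
  set I2 := (𝓡 (n + 1)).prod 𝓘(ℝ, ℝ) with hI2
  set T : bM.carrier × ℝ → P := fun q ↦ expMap g.leviCivita (jM (bM.incl q.1))
    (q.2 • mfderiv (𝓡∂ (n + 2)) (𝓡 (n + 2)) jM (bM.incl q.1) (-νM q.1)) with hT
  set ι : bM.carrier → P := fun y ↦ jM (bM.incl y) with hι
  set ν : Π y : bM.carrier, TangentSpace (𝓡 (n + 2)) (ι y) :=
    fun y ↦ mfderiv (𝓡∂ (n + 2)) (𝓡 (n + 2)) jM (bM.incl y) (-νM y) with hν
  have hjMs : ContMDiff (𝓡∂ (n + 2)) (𝓡 (n + 2)) ∞ jM := hjM.contMDiff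
  have hincl : ContMDiff (𝓡 (n + 1)) (𝓡∂ (n + 2)) ∞ bM.incl := bM.isSmoothEmbedding.contMDiff
  have htan : ContMDiff (𝓡∂ (n + 2)).tangent (𝓡 (n + 2)).tangent 1
      (tangentMap (𝓡∂ (n + 2)) (𝓡 (n + 2)) jM) :=
    hjMs.contMDiff_tangentMap (by exact WithTop.coe_le_coe.2 le_top)
  have hν2lift : ContMDiff (𝓡 (n + 1)) (𝓡 (n + 2)).tangent 1
      (fun y ↦ (TotalSpace.mk' (EuclideanSpace ℝ (Fin (n + 2))) (ι y)
        (mfderiv (𝓡∂ (n + 2)) (𝓡 (n + 2)) jM (bM.incl y) (νM y)) :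
        TangentBundle (𝓡 (n + 2)) P)) :=
    htan.comp (hνs.of_le (by exact_mod_cast le_top))
  have hνlift : ContMDiff (𝓡 (n + 1)) (𝓡 (n + 2)).tangent 1
      (fun y ↦ (TotalSpace.mk' (EuclideanSpace ℝ (Fin (n + 2))) (ι y) (ν y) :
        TangentBundle (𝓡 (n + 2)) P)) :=
    htan.comp ((contMDiff_totalSpaceMk_neg hνs).of_le (by exact_mod_cast le_top))
  have hνneglift : ContMDiff (𝓡 (n + 1)) (𝓡 (n + 2)).tangent 1
      (fun y ↦ (TotalSpace.mk' (EuclideanSpace ℝ (Fin (n + 2))) (ι y)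
        (-mfderiv (𝓡∂ (n + 2)) (𝓡 (n + 2)) jM (bM.incl y) (νM y)) :
        TangentBundle (𝓡 (n + 2)) P)) :=
    contMDiff_totalSpaceMk_neg hν2lift
  have hyint : (𝓡 (n + 1)).IsInteriorPoint z := BoundarylessManifold.isInteriorPoint
  -- the pulled-back identity `ĝ(djM ·, djM ·) = g_M` as an equality of metrics
  have hjMinj : ∀ a : M, Injective (mfderiv (𝓡∂ (n + 2)) (𝓡 (n + 2)) jM a) := fun a ↦
    injective_mfderiv_of_isImmersionAt' (hjM.isImmersion.isImmersionAt a)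
  set gJ := g.comap (contMDiff_pullbackBilin_holds (I := 𝓡 (n + 2)) (M := P)
    (I' := 𝓡∂ (n + 2)) (N := M)) jM hjMs hjMinj rfl with hgJ
  haveI := gJ.hasLeviCivita
  have hgJ_eq : gJ = gM :=
    metric_ext' fun a ↦ ContinuousLinearMap.ext fun v ↦ ContinuousLinearMap.ext fun w ↦ by
      rw [hgJ, val_comap, pullbackBilin_apply, hpull]
  have hfJ : gJ.IsSpacelikeImmersion (𝓡 (n + 1)) bM.incl := by rw [hgJ_eq]; exact hfM
  -- `jM ∘ incl` is a spacelike immersion of `(P, ĝ)`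
  have hchain : ∀ (y : bM.carrier) (v : TangentSpace (𝓡 (n + 1)) y),
      mfderiv (𝓡 (n + 1)) (𝓡 (n + 2)) (jM ∘ bM.incl) y v =
        mfderiv (𝓡∂ (n + 2)) (𝓡 (n + 2)) jM (bM.incl y)
          (mfderiv (𝓡 (n + 1)) (𝓡∂ (n + 2)) bM.incl y v) := by
    intro y v
    rw [mfderiv_comp y ((hjMs _).mdifferentiableAt (by simp))
      ((hincl y).mdifferentiableAt (by simp))]
    rfl
  have hιsp : g.IsSpacelikeImmersion (𝓡 (n + 1)) (jM ∘ bM.incl) := by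
    refine ⟨hjMs.comp hincl, fun y v hv ↦ ?_⟩
    show 0 < g.val (jM (bM.incl y)) (mfderiv (𝓡 (n + 1)) (𝓡 (n + 2)) (jM ∘ bM.incl) y v)
      (mfderiv (𝓡 (n + 1)) (𝓡 (n + 2)) (jM ∘ bM.incl) y v)
    rw [hchain, hpull]
    exact hfM.2 y v hv
  -- (F) naturality along `jM`: `H^ĝ_{jM ∘ incl, djM ν_M} = H^{g_M}_{incl, ν_M}`
  have hF : g.meanCurvature (jM ∘ bM.incl)
      (contMDiff_pullbackBilin_holds (I := 𝓡 (n + 2)) (M := P) (I' := 𝓡 (n + 1))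
        (N := bM.carrier)) hιsp
      (fun y ↦ mfderiv (𝓡∂ (n + 2)) (𝓡 (n + 2)) jM (bM.incl y) (νM y)) z =
      gM.meanCurvature bM.incl
        (contMDiff_pullbackBilin_holds (I := 𝓡∂ (n + 2)) (M := M) (I' := 𝓡 (n + 1))
          (N := bM.carrier)) hfM νM z := by
    have key := meanCurvature_comap g _ hjMs hjMinj rfl
      (contMDiff_pullbackBilin_holds (I := 𝓡∂ (n + 2)) (M := M) (I' := 𝓡 (n + 1))
        (N := bM.carrier))
      (contMDiff_pullbackBilin_holds (I := 𝓡 (n + 2)) (M := P) (I' := 𝓡 (n + 1))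
        (N := bM.carrier)) hfJ hιsp (ν := νM) hyint ((hνs z).mdifferentiableAt (by simp))
    rw [← key]
    exact meanCurvature_congr_metric' hgJ_eq bM.incl _ hfJ hfM νM z
  -- the open slab `W = ∂M × (-ε, ε)` and the two honest pullback metrics on it
  have h0 : (0 : ℝ) ∈ Ioo (-ε) ε := ⟨by linarith, hε⟩
  have hUo : IsOpen ((univ : Set bM.carrier) ×ˢ Ioo (-ε) ε) := isOpen_univ.prod isOpen_Ioo
  set W : TopologicalSpace.Opens (bM.carrier × ℝ) :=
    ⟨(univ : Set bM.carrier) ×ˢ Ioo (-ε) ε, hUo⟩ with hW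
  have hmemW : ∀ u : W, u.1.2 ∈ Ioo (-ε) ε := fun u ↦ u.2.2
  set Φ : W → P := T ∘ Subtype.val with hΦdef
  have hTu : ∀ u : W, MDifferentiableAt I2 (𝓡 (n + 2)) T u.1 := fun u ↦
    (hEs u.1 (hmemW u)).mdifferentiableAt (by simp)
  have hΦ : ContMDiff I2 (𝓡 (n + 2)) (∞ + 1) Φ := fun u ↦
    (hEs u.1 (hmemW u)).comp u (contMDiff_subtype_val u)
  have hΦ' : ∀ u, Injective (mfderiv I2 (𝓡 (n + 2)) Φ u) := fun u ↦ by
    rw [hΦdef, mfderiv_comp_subtypeVal (hTu u)]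
    exact hEinj u.1 (hmemW u)
  have hιW : ContMDiff I2 I2 (∞ + 1) (Subtype.val : W → bM.carrier × ℝ) := contMDiff_subtype_val
  have hιW' : ∀ u : W, Injective (mfderiv I2 I2 (Subtype.val : W → bM.carrier × ℝ) u) :=
    fun u ↦ by
    rw [mfderiv_subtypeVal]
    exact fun v w h ↦ h
  have hdim : Module.finrank ℝ (EuclideanSpace ℝ (Fin (n + 1)) × ℝ) =
      Module.finrank ℝ (EuclideanSpace ℝ (Fin (n + 2))) := by
    rw [finrank_cylModel, finrank_euclideanSpace, finrank_euclideanSpace, Fintype.card_fin,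
      Fintype.card_fin]
  set gΦ := g.comap (contMDiff_pullbackBilin_holds (I := 𝓡 (n + 2)) (M := P) (I' := I2)
    (N := W)) Φ hΦ hΦ' hdim with hgΦ
  set GW := G.comap (contMDiff_pullbackBilin_holds (I := I2) (M := bM.carrier × ℝ) (I' := I2)
    (N := W)) Subtype.val hιW hιW' rfl with hGW
  haveI := gΦ.hasLeviCivita
  haveI := GW.hasLeviCivita
  have hvals : gΦ = GW := by
    refine metric_ext' fun u ↦ ContinuousLinearMap.ext fun v ↦ ContinuousLinearMap.ext fun w ↦ ?_
    obtain ⟨⟨z', t'⟩, hu⟩ := u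
    show pullbackBilin (I := 𝓡 (n + 2)) (I' := I2) Φ g.val ⟨(z', t'), hu⟩ v w =
      pullbackBilin (I := I2) (I' := I2) (Subtype.val : W → bM.carrier × ℝ) G.val
        ⟨(z', t'), hu⟩ v w
    rw [pullbackBilin_apply, pullbackBilin_apply, hΦdef, mfderiv_comp_subtypeVal
      (hTu ⟨(z', t'), hu⟩), mfderiv_subtypeVal, hGval z' t' hu.2, pullbackBilin_apply]
    rfl
  -- the slice `t = 0` as a map into `W`, its differential, and the field `∂_t` along it
  set sl : bM.carrier → W := fun y ↦ ⟨((y, (0 : ℝ)) : bM.carrier × ℝ), ⟨mem_univ _, h0⟩⟩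
    with hsl
  have hsl_val : (Subtype.val ∘ sl) = fun y : bM.carrier ↦ ((y, (0 : ℝ)) : bM.carrier × ℝ) :=
    rfl
  have hsls : ContMDiff (𝓡 (n + 1)) I2 ∞ sl := by
    rw [← ContMDiff.subtypeVal_comp_iff W sl, hsl_val]
    exact contMDiff_cylSlice (I' := 𝓡 (n + 1)) 0
  set νc : Π y : bM.carrier, TangentSpace I2 (((y, (0 : ℝ)) : bM.carrier × ℝ)) :=
    fun y ↦ velocity I2 (fun s : ℝ ↦ ((y, s) : bM.carrier × ℝ)) 0 with hνc
  have hνc_lift : ContMDiff (𝓡 (n + 1)) I2.tangent ∞ (fun y ↦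
      (TotalSpace.mk' (EuclideanSpace ℝ (Fin (n + 1)) × ℝ) ((y, (0 : ℝ)) : bM.carrier × ℝ)
        (νc y) : TangentBundle I2 (bM.carrier × ℝ))) :=
    contMDiff_lift_velocity_cylSlice (I' := 𝓡 (n + 1)) (N := bM.carrier) 0
  have hνW : MDifferentiableAt (𝓡 (n + 1)) I2.tangent
      (fun y ↦ (TotalSpace.mk' (EuclideanSpace ℝ (Fin (n + 1)) × ℝ) (sl y) (νc y) :
        TangentBundle I2 W)) z :=
    (mdifferentiableAt_totalSpace_opens_iff' W (b := sl) (s := νc)).2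
      ((hνc_lift z).mdifferentiableAt (by simp))
  have hvsl : G.IsSpacelikeImmersion (𝓡 (n + 1)) (Subtype.val ∘ sl) :=
    isSpacelikeImmersion_cylSlice G hG 0
  have hfW : GW.IsSpacelikeImmersion (𝓡 (n + 1)) sl := by
    refine ⟨hsls, fun y v hv ↦ ?_⟩
    rw [hGW, inducedBilin_comap G _ hιW hιW' rfl ((hsls y).mdifferentiableAt (by simp))
      (hasMFDerivAt_subtypeVal (sl y)).mdifferentiableAt]
    exact hvsl.2 y v hv
  have hfΦ : gΦ.IsSpacelikeImmersion (𝓡 (n + 1)) sl := by rw [hvals]; exact hfW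
  have hΦsl : g.IsSpacelikeImmersion (𝓡 (n + 1)) (Φ ∘ sl) := by
    have hΦinf : ContMDiff I2 (𝓡 (n + 2)) ∞ Φ := hΦ
    refine ⟨hΦinf.comp hsls, fun y v hv ↦ ?_⟩
    rw [← inducedBilin_comap g _ hΦ hΦ' hdim ((hsls y).mdifferentiableAt (by simp))
      ((hΦinf (sl y)).mdifferentiableAt (by simp))]
    exact hfΦ.2 y v hv
  -- (A) restriction to the slab: `H^{G|_W} = H^G`
  have hA : GW.meanCurvature sl
      (contMDiff_pullbackBilin_holds (I := I2) (M := W) (I' := 𝓡 (n + 1)) (N := bM.carrier))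
      hfW (fun y ↦ νc y) z =
      G.meanCurvature (fun y : bM.carrier ↦ ((y, (0 : ℝ)) : bM.carrier × ℝ))
        (contMDiff_pullbackBilin_holds (I := I2) (M := bM.carrier × ℝ) (I' := 𝓡 (n + 1))
          (N := bM.carrier))
        (isSpacelikeImmersion_cylSlice G hG 0) νc z := by
    have key := meanCurvature_comap G _ hιW hιW' rfl
      (contMDiff_pullbackBilin_holds (I := I2) (M := W) (I' := 𝓡 (n + 1)) (N := bM.carrier))
      (contMDiff_pullbackBilin_holds (I := I2) (M := bM.carrier × ℝ) (I' := 𝓡 (n + 1))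
        (N := bM.carrier)) hfW hvsl (ν := fun y ↦ νc y) hyint hνW
    rw [key]
    exact meanCurvature_congr_fun G hsl_val (fun y ↦ by rw [mfderiv_subtypeVal]; rfl) _ hvsl
      _ z
  -- (B) the two pullback metrics on the slab agree
  have hB : gΦ.meanCurvature sl
      (contMDiff_pullbackBilin_holds (I := I2) (M := W) (I' := 𝓡 (n + 1)) (N := bM.carrier))
      hfΦ (fun y ↦ νc y) z =
      GW.meanCurvature sl
        (contMDiff_pullbackBilin_holds (I := I2) (M := W) (I' := 𝓡 (n + 1)) (N := bM.carrier))
        hfW (fun y ↦ νc y) z :=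
    meanCurvature_congr_metric' hvals sl _ hfΦ hfW _ z
  -- (C) naturality along `E|_W`
  have hC : gΦ.meanCurvature sl
      (contMDiff_pullbackBilin_holds (I := I2) (M := W) (I' := 𝓡 (n + 1)) (N := bM.carrier))
      hfΦ (fun y ↦ νc y) z =
      g.meanCurvature (Φ ∘ sl)
        (contMDiff_pullbackBilin_holds (I := 𝓡 (n + 2)) (M := P) (I' := 𝓡 (n + 1))
          (N := bM.carrier)) hΦsl (fun y ↦ mfderiv I2 (𝓡 (n + 2)) Φ (sl y) (νc y)) z :=
    meanCurvature_comap g _ hΦ hΦ' hdim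
      (contMDiff_pullbackBilin_holds (I := I2) (M := W) (I' := 𝓡 (n + 1)) (N := bM.carrier))
      (contMDiff_pullbackBilin_holds (I := 𝓡 (n + 2)) (M := P) (I' := 𝓡 (n + 1))
        (N := bM.carrier)) hfΦ hΦsl hyint hνW
  -- (D) `E(·, 0) = jM ∘ incl` and `dE(∂_t) = d(jM)(-ν_M)`
  have hΦsl_eq : (Φ ∘ sl) = (jM ∘ bM.incl) := by
    funext y
    show expMap g.leviCivita (ι y) ((0 : ℝ) • ν y) = ι y
    exact normalExp_zero (cov := g.leviCivita) y
  have hdT1 : ∀ y : bM.carrier,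
      mfderiv I2 (𝓡 (n + 2)) (fun q : bM.carrier × ℝ ↦ expMap g.leviCivita (ι q.1) (q.2 • ν q.1))
        (y, 0) ((((0 : EuclideanSpace ℝ (Fin (n + 1))), (1 : ℝ))) :
          TangentSpace I2 (y, (0 : ℝ))) = ν y := by
    intro y
    have h := mfderiv_normalExp_zero_apply' (cov := g.leviCivita) (k := 1) le_rfl hνlift y 0 1
    rw [map_zero, zero_add, one_smul] at h
    exact h
  have hνeq : ∀ y : bM.carrier,
      (mfderiv I2 (𝓡 (n + 2)) Φ (sl y) (νc y) : EuclideanSpace ℝ (Fin (n + 2))) = ν y := by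
    intro y
    rw [hΦdef, mfderiv_comp_subtypeVal (hTu (sl y))]
    show mfderiv I2 (𝓡 (n + 2)) T (y, 0)
      (velocity I2 (fun s : ℝ ↦ ((y, s) : bM.carrier × ℝ)) 0) = ν y
    rw [velocity_cylLine]
    exact hdT1 y
  have hD : g.meanCurvature (Φ ∘ sl)
      (contMDiff_pullbackBilin_holds (I := 𝓡 (n + 2)) (M := P) (I' := 𝓡 (n + 1))
        (N := bM.carrier)) hΦsl (fun y ↦ mfderiv I2 (𝓡 (n + 2)) Φ (sl y) (νc y)) z =
      g.meanCurvature (jM ∘ bM.incl)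
        (contMDiff_pullbackBilin_holds (I := 𝓡 (n + 2)) (M := P) (I' := 𝓡 (n + 1))
          (N := bM.carrier)) hιsp (fun y ↦ ν y) z :=
    meanCurvature_congr_fun g hΦsl_eq hνeq _ hΦsl hιsp z
  -- (E) `H_{-ν} = -H_ν`
  have hE : g.meanCurvature (jM ∘ bM.incl)
      (contMDiff_pullbackBilin_holds (I := 𝓡 (n + 2)) (M := P) (I' := 𝓡 (n + 1))
        (N := bM.carrier)) hιsp (fun y ↦ ν y) z =
      -g.meanCurvature (jM ∘ bM.incl)
        (contMDiff_pullbackBilin_holds (I := 𝓡 (n + 2)) (M := P) (I' := 𝓡 (n + 1))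
          (N := bM.carrier)) hιsp
        (fun y ↦ mfderiv (𝓡∂ (n + 2)) (𝓡 (n + 2)) jM (bM.incl y) (νM y)) z := by
    have h1 : g.meanCurvature (jM ∘ bM.incl)
        (contMDiff_pullbackBilin_holds (I := 𝓡 (n + 2)) (M := P) (I' := 𝓡 (n + 1))
          (N := bM.carrier)) hιsp (fun y ↦ ν y) z =
        g.meanCurvature (jM ∘ bM.incl)
          (contMDiff_pullbackBilin_holds (I := 𝓡 (n + 2)) (M := P) (I' := 𝓡 (n + 1))
            (N := bM.carrier)) hιsp
          (fun y ↦ -mfderiv (𝓡∂ (n + 2)) (𝓡 (n + 2)) jM (bM.incl y) (νM y)) z :=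
      meanCurvature_congr_fun g rfl (fun y ↦ by
        show mfderiv (𝓡∂ (n + 2)) (𝓡 (n + 2)) jM (bM.incl y) (-νM y) = _
        rw [map_neg]) _ hιsp hιsp z
    rw [h1]
    exact meanCurvature_neg_normal g _ hιsp hyint ((hν2lift z).mdifferentiableAt one_ne_zero)
      ((hνneglift z).mdifferentiableAt one_ne_zero)
  -- assemble
  rw [← hA, ← hB, hC, hD, hE, hF]

end SliceZero

end Literature.Geometry.Riemannian
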